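import Literature.AlgebraicGeometry.FundamentalGroup.HypersurfaceComplementPencilDiscriminant
import Literature.AlgebraicTopology.FundamentalGroup.PuncturedPlaneLoopsOffDiscs
import Literature.AlgebraicTopology.FundamentalGroup.LineSliceLoops
import Mathlib.Analysis.Calculus.ImplicitFunction.ProdDomain
import Mathlib.Analysis.Calculus.ContDiff.RCLike
import HarnessLib

/-!
# The image of `π₁` of the punctured lines of a pencil is locally constant in the direction
# (local step of Zariski's theorem for the complement of an affine hypersurface)

Topic `Literature/AlgebraicGeometry/FundamentalGroup`.  For `h ∈ ℂ[xᵢ : i ∈ ι]`, `U = ℂ^ι ∖ V(h)`,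
a base point `b` and a direction `v₀` with `pencilDiscr h (b, v₀) ≠ 0` (file
`HypersurfaceComplementPencilDiscriminant`: `b ∈ U`, the line `c ↦ b + c v₀` keeps its degree at
infinity and meets `V(h)` transversally), the image

  `H_v = im(π₁(Λ_{b,v}, 0) → π₁(U, b))`,  `Λ_{b,v} = {c | b + c v ∈ U}`,

is the SAME for all directions `v` near `v₀` (`exists_ball_range_lineInclHom_eq`).  This is the local
step of Zariski's theorem on generic pencils (Dimca, Ch. 4 Prop. (3.1); Voisin II Thm. 3.22; file
`HypersurfaceComplementZariskiPencils` for the global statement): the transversal punctured lines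
through `b` form a locally trivial family.

## Proof (elementary; tree tools only)

1. (§1–§2, root cloud) The roots of `c ↦ h(b + c v₀)` are simple, so by the implicit function
   theorem (Mathlib's `HasStrictFDerivAt.implicitFunctionOfProdDomain`) each root `a` continues to a
   root `ψ_a(v) → a` of the nearby lines `v → v₀` (`exists_rootBranch`); since the number of roots is
   maximal at `v₀` (`ncard_lineRoots_of_pencilDiscr`) and never larger (`ncard_lineRoots_le`), for `v`
   near `v₀` the roots of the line `v` are EXACTLY the `ψ_a(v)`, one in each small disc `D(a, ε)`
   (`eventually_lineRoots_configuration`).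
2. (§3) Loops of the punctured line `v` push off the discs (`OffDiscs.exists_mk_eq_forall_le_dist`),
   and off the discs the punctured lines `v_s` of the segment from `v` to `v₀` all contain the loop,
   so `(s, t) ↦ b + γ(t) v_s` is a homotopy in `U` (`range_lineInclHom_le_of_discs`); both
   inclusions follow.

## References

* A. Dimca, *Singularities and Topology of Hypersurfaces*, Universitext (1992), Ch. 4 §3 Prop. (3.1)
  (held text p. 115). [Dimca1992]
* C. Voisin, *Hodge Theory and Complex Algebraic Geometry II*, CUP (2003), §3.2.2 Thm. 3.22.
  [VoisinHodgeII2003]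
* A. Hatcher, *Algebraic Topology* (2002), §1.1 Prop. 1.17–1.18, Lemma 1.19. [HatcherAT2002]

## Design notes

* Everything is proved; no definitions, no named facts, no `sorry`.
* `_root_.FundamentalGroup` is written in full (CONVENTIONS.md §2).
-/

noncomputable section

open MvPolynomial Set Filter Metric unitInterval
open scoped Polynomial Topology
open Literature.AlgebraicTopology.FundamentalGroup

namespace Literature.AlgebraicGeometry.FundamentalGroup

variable {ι : Type} [Fintype ι]

/-! ### §1 Simple roots persist: the implicit-function root branch -/

section RootBranch

/-- Evaluation of a polynomial in several variables is a smooth function of the point. [folklore] -/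
private theorem contDiff_mvPolynomial_eval (f : MvPolynomial ι ℂ) {n : WithTop ℕ∞} :
    ContDiff ℂ n (fun x : ι → ℂ => MvPolynomial.eval x f) := by
  induction f using MvPolynomial.induction_on with
  | C a => simpa using contDiff_const
  | add p q hp hq => simpa using hp.add hq
  | mul_X p k hp => simpa using hp.mul (contDiff_apply ℂ ℂ k)

variable {h : MvPolynomial ι ℂ} {b v₀ : ι → ℂ} {a : ℂ}

/-- **A simple root of the restriction to a line persists on the nearby lines of the pencil**:
if `h(b + a v₀) = 0` with `d/dc h(b + c v₀)|_{c = a} ≠ 0`, there is a root branch `ψ(v) → a`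
(`v → v₀`) with `h(b + ψ(v) v) = 0` for `v` near `v₀` (implicit function theorem for
`(v, c) ↦ h(b + c v)`). [cite: Dimca1992, Ch. 4 §3 Prop. (3.1) (proof: transversal intersections are stable)] -/
theorem exists_rootBranch (ha : MvPolynomial.eval (b + a • v₀) h = 0)
    (ha' : (Polynomial.derivative (linePoly h b v₀)).eval a ≠ 0) :
    ∃ ψ : (ι → ℂ) → ℂ, Tendsto ψ (𝓝 v₀) (𝓝 a) ∧ ∀ᶠ v in 𝓝 v₀, MvPolynomial.eval (b + ψ v • v) h = 0 := by
  let F : (ι → ℂ) × ℂ → ℂ := fun p => MvPolynomial.eval (b + p.2 • p.1) h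
  have hF : ContDiff ℂ ⊤ F :=
    (contDiff_mvPolynomial_eval h).comp (contDiff_const.add (contDiff_snd.smul contDiff_fst))
  have dfu : HasStrictFDerivAt F (fderiv ℂ F (v₀, a)) (v₀, a) := hF.contDiffAt.hasStrictFDerivAt (by simp)
  -- the partial derivative in `c` is multiplication by `D = (linePoly h b v₀)'(a) ≠ 0`
  set D : ℂ := (Polynomial.derivative (linePoly h b v₀)).eval a with hD
  have hcomp : HasFDerivAt (fun c : ℂ => F (v₀, c))
      ((fderiv ℂ F (v₀, a)).comp (ContinuousLinearMap.inr ℂ (ι → ℂ) ℂ)) a :=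
    dfu.hasFDerivAt.comp a (hasFDerivAt_prodMk_right v₀ a)
  have hderiv : HasDerivAt (fun c : ℂ => F (v₀, c)) D a := by
    have he : (fun c : ℂ => F (v₀, c)) = fun c => (linePoly h b v₀).eval c := by
      funext c; exact (eval_linePoly h b v₀ c).symm
    rw [he, hD]
    exact Polynomial.hasDerivAt _ _
  have hval : ((fderiv ℂ F (v₀, a)).comp (ContinuousLinearMap.inr ℂ (ι → ℂ) ℂ)) 1 = D :=
    hcomp.hasDerivAt.unique hderiv
  have if₂u : ((fderiv ℂ F (v₀, a)).comp (ContinuousLinearMap.inr ℂ (ι → ℂ) ℂ)).IsInvertible := by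
    refine ⟨ContinuousLinearEquiv.unitsEquivAut ℂ (Units.mk0 D ha'), ContinuousLinearMap.ext_ring ?_⟩
    rw [hval, ContinuousLinearEquiv.coe_coe, ContinuousLinearEquiv.unitsEquivAut_apply, Units.val_mk0, one_mul]
  refine ⟨dfu.implicitFunctionOfProdDomain if₂u, dfu.tendsto_implicitFunctionOfProdDomain if₂u, ?_⟩
  have hev := dfu.eventually_apply_implicitFunctionOfProdDomain if₂u
  have hF0 : F (v₀, a) = 0 := ha
  filter_upwards [hev] with v hv
  rw [hF0] at hv
  exact hv

end RootBranch

/-! ### §2 The root cloud of the nearby lines -/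

section RootCloud

variable {h : MvPolynomial ι ℂ} {b v₀ : ι → ℂ}

omit [Fintype ι] in
/-- At a pointed line with `pencilDiscr ≠ 0` every root of the restriction is simple. [cite: Dimca1992, Ch. 4 §3 Prop. (3.1) (transversal intersection)] -/
theorem eval_derivative_ne_zero_of_pencilDiscr (hQ : MvPolynomial.eval (Sum.elim b v₀) (pencilDiscr h) ≠ 0)
    {a : ℂ} (ha : MvPolynomial.eval (b + a • v₀) h = 0) :
    (Polynomial.derivative (linePoly h b v₀)).eval a ≠ 0 := by
  have hsep := separable_linePoly_of_pencilDiscr hQ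
  rw [Polynomial.separable_def, Polynomial.isCoprime_iff_aeval_ne_zero_of_isAlgClosed (k := ℂ) ℂ] at hsep
  rcases hsep a with h1 | h1
  · rw [Polynomial.coe_aeval_eq_eval, eval_linePoly] at h1
    exact absurd ha h1
  · rwa [Polynomial.coe_aeval_eq_eval] at h1

/-- **The root cloud of the nearby lines.**  Let `pencilDiscr h (b, v₀) ≠ 0` and let `ε > 0` be so
small that the discs `D(a, ε)` around the roots `a` of the line `v₀` satisfy `2ε ≤ |a - a'|`.  Then
for `v` near `v₀` the roots of the line `v` are distributed EXACTLY ONE IN EACH disc: there is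
`z : roots(v₀) → roots(v)` with `z a ∈ D(a, ε)`, every root of `v` lies in some disc, and the root of
`v` in `D(a, ε)` is `z a`.  (Root branches from `exists_rootBranch`; they are distinct as the discs
are disjoint; there are no other roots since `|roots(v)| ≤ deg = |roots(v₀)|`,
`ncard_lineRoots_le`, `ncard_lineRoots_of_pencilDiscr`.) [cite: Dimca1992, Ch. 4 §3 Prop. (3.1) and the note after it (`d` transversal intersection points, stable under perturbation)] -/
theorem eventually_lineRoots_configuration (hQ : MvPolynomial.eval (Sum.elim b v₀) (pencilDiscr h) ≠ 0)
    {ε : ℝ} (hε : 0 < ε)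
    (hsep : ∀ a ∈ lineRoots ![h] b v₀, ∀ a' ∈ lineRoots ![h] b v₀, a ≠ a' → 2 * ε ≤ dist a a') :
    ∀ᶠ v in 𝓝 v₀, ∃ z : ℂ → ℂ,
      (∀ a ∈ lineRoots ![h] b v₀, z a ∈ ball a ε ∧ z a ∈ lineRoots ![h] b v) ∧
      (∀ u ∈ lineRoots ![h] b v, ∃ a ∈ lineRoots ![h] b v₀, u ∈ ball a ε) ∧
      (∀ a ∈ lineRoots ![h] b v₀, ∀ u ∈ lineRoots ![h] b v, u ∈ ball a ε → u = z a) := by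
  classical
  have hb : MvPolynomial.eval b h ≠ 0 := eval_ne_zero_of_pencilDiscr hQ
  have hbU : b ∈ affineHypersurfaceComplement ![h] := mem_affineHypersurfaceComplement_of_pencilDiscr hQ
  set R₀ := lineRoots ![h] b v₀ with hR₀
  have hR₀fin : R₀.Finite := lineRoots_finite hbU v₀
  have hmemR : ∀ {v : ι → ℂ} {c : ℂ}, c ∈ lineRoots ![h] b v ↔ MvPolynomial.eval (b + c • v) h = 0 := by
    intro v c
    rw [lineRoots_eq_setOf_isRoot, mem_setOf_eq, isRoot_linePoly_iff]
  -- root branches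
  have key : ∀ a ∈ R₀, ∃ ψ : (ι → ℂ) → ℂ, Tendsto ψ (𝓝 v₀) (𝓝 a) ∧
      ∀ᶠ v in 𝓝 v₀, MvPolynomial.eval (b + ψ v • v) h = 0 := by
    intro a ha
    have ha0 : MvPolynomial.eval (b + a • v₀) h = 0 := hmemR.1 ha
    exact exists_rootBranch ha0 (eval_derivative_ne_zero_of_pencilDiscr hQ ha0)
  choose! ψ hψt hψr using key
  have hev : ∀ᶠ v in 𝓝 v₀, ∀ a ∈ hR₀fin.toFinset, ψ a v ∈ ball a ε ∧ MvPolynomial.eval (b + ψ a v • v) h = 0 := by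
    rw [Finset.eventually_all]
    intro a ha
    rw [Set.Finite.mem_toFinset] at ha
    exact ((hψt a ha).eventually_mem (ball_mem_nhds a hε)).and (hψr a ha)
  filter_upwards [hev] with v hv
  simp only [Set.Finite.mem_toFinset] at hv
  refine ⟨fun a => ψ a v, fun a ha => ⟨(hv a ha).1, hmemR.2 (hv a ha).2⟩, ?_⟩
  -- the branches are distinct and exhaust the roots of the line `v`
  have hinj : Set.InjOn (fun a => ψ a v) R₀ := by
    intro a ha a' ha' heq
    by_contra hne
    have h1 : dist (ψ a v) a < ε := mem_ball.1 (hv a ha).1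
    have h2 : dist (ψ a' v) a' < ε := mem_ball.1 (hv a' ha').1
    have h3 := hsep a ha a' ha' hne
    have h4 : dist a a' ≤ dist a (ψ a v) + dist (ψ a v) a' := dist_triangle _ _ _
    have h5 : dist (ψ a v) a' < ε := by rw [show ψ a v = ψ a' v from heq]; exact h2
    have h6 := dist_comm a (ψ a v)
    linarith
  have hsub : (fun a => ψ a v) '' R₀ ⊆ lineRoots ![h] b v := by
    rintro _ ⟨a, ha, rfl⟩
    exact hmemR.2 (hv a ha).2
  have heq : (fun a => ψ a v) '' R₀ = lineRoots ![h] b v := by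
    refine Set.eq_of_subset_of_ncard_le hsub ?_ (lineRoots_finite hbU v)
    rw [hinj.ncard_image, hR₀, ncard_lineRoots_of_pencilDiscr hQ]
    exact ncard_lineRoots_le hb v
  refine ⟨fun u hu => ?_, fun a ha u hu hua => ?_⟩
  · rw [← heq] at hu
    obtain ⟨a, ha, rfl⟩ := hu
    exact ⟨a, ha, (hv a ha).1⟩
  · rw [← heq] at hu
    obtain ⟨a', ha', rfl⟩ := hu
    by_cases haa' : a' = a
    · rw [haa']
    · exfalso
      have h1 : dist (ψ a' v) a' < ε := mem_ball.1 (hv a' ha').1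
      have h2 : dist (ψ a' v) a < ε := mem_ball.1 hua
      have h3 := hsep a' ha' a ha haa'
      linarith [dist_triangle_left a' a (ψ a' v)]

end RootCloud

/-! ### §3 Local constancy of the image of `π₁` of the punctured lines -/

section LocalConstancy

variable {h : MvPolynomial ι ℂ} {b : ι → ℂ}

/-- The slice of `U = ℂ^ι ∖ V(h)` by the line through `b` and `b + v` is the plane minus the roots
of the restriction. [cite: Dimca1992, Ch. 4 §3 Prop. (3.1)] -/
theorem lineSlice_add_eq (b v : ι → ℂ) :
    LineSlice.lineSlice (affineHypersurfaceComplement ![h]) b (b + v) = univ \ lineRoots ![h] b v := by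
  rw [lineSlice_eq, add_sub_cancel_left]

/-- `c` lies in the slice of the line `(b, v)` iff `h(b + c v) ≠ 0`. [cite: Dimca1992, Ch. 4 §3 Prop. (3.1)] -/
theorem mem_lineSlice_add_iff (b v : ι → ℂ) (c : ℂ) :
    c ∈ LineSlice.lineSlice (affineHypersurfaceComplement ![h]) b (b + v) ↔ MvPolynomial.eval (b + c • v) h ≠ 0 := by
  rw [lineSlice_add_eq, Set.mem_sdiff, lineRoots_eq_setOf_isRoot, mem_setOf_eq, isRoot_linePoly_iff]
  exact ⟨fun hc => hc.2, fun hc => ⟨mem_univ _, hc⟩⟩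

omit [Fintype ι] in
/-- `OffDiscs.exists_mk_eq_forall_le_dist` transported to a set EQUAL to a punctured plane (the
slice). [cite: HatcherAT2002, §1.1 Prop. 1.17 and Prop. 1.18] -/
private theorem exists_mk_eq_forall_le_dist' {Λ F : Set ℂ} (hΛ : Λ = univ \ F) {A : Finset ℂ} {ε : ℝ}
    {z : ℂ → ℂ} (hsep : ∀ a ∈ A, ∀ a' ∈ A, a ≠ a' → 2 * ε ≤ dist a a')
    (hz : ∀ a ∈ A, z a ∈ ball a ε) (hzF : ∀ a ∈ A, z a ∈ F) (hF : ∀ u ∈ F, ∃ a ∈ A, u ∈ ball a ε)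
    (huniq : ∀ a ∈ A, ∀ u ∈ F, u ∈ ball a ε → u = z a) {x : ↥Λ}
    (hx : ∀ a ∈ A, ε ≤ dist (x : ℂ) a) (γ : Path x x) :
    ∃ γ' : Path x x, Path.Homotopic.Quotient.mk γ = Path.Homotopic.Quotient.mk γ' ∧
      ∀ t, ∀ a ∈ A, ε ≤ dist (γ' t : ℂ) a := by
  subst hΛ
  exact OffDiscs.exists_mk_eq_forall_le_dist hsep hz hzF hF huniq hx γ

/-- **Transfer of loops between two nearby punctured lines of the pencil at `b`.**  Suppose the
roots of the line `v₁` lie in the discs `D(a, ε)`, `a ∈ A`, exactly one (`z a`) in each, the discs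
are separated (`2ε ≤ |a - a'|`) and avoid `0` (`ε ≤ |a|`), and the roots of EVERY line
`v_s = (1 - s) v₁ + s v₂`, `s ∈ [0, 1]`, of the segment lie in the discs.  Then the image of
`π₁(Λ_{v₁}, 0)` in `π₁(U, b)` is contained in that of `π₁(Λ_{v₂}, 0)`: push a loop of `Λ_{v₁}` off
the discs, then move the line (`(s, t) ↦ b + γ(t) v_s` stays in `U`).
[cite: Dimca1992, Ch. 4 §3 Prop. (3.1) (proof)] [cite: HatcherAT2002, §1.1 Lemma 1.19] -/
theorem range_lineInclHom_le_of_discs (hb : b ∈ affineHypersurfaceComplement ![h]) {v₁ v₂ : ι → ℂ}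
    {A : Finset ℂ} {ε : ℝ} {z : ℂ → ℂ} (hsep : ∀ a ∈ A, ∀ a' ∈ A, a ≠ a' → 2 * ε ≤ dist a a')
    (h0 : ∀ a ∈ A, ε ≤ ‖a‖) (hz : ∀ a ∈ A, z a ∈ ball a ε) (hzF : ∀ a ∈ A, z a ∈ lineRoots ![h] b v₁)
    (hF : ∀ u ∈ lineRoots ![h] b v₁, ∃ a ∈ A, u ∈ ball a ε)
    (huniq : ∀ a ∈ A, ∀ u ∈ lineRoots ![h] b v₁, u ∈ ball a ε → u = z a)
    (hseg : ∀ s : ℝ, 0 ≤ s → s ≤ 1 → ∀ u ∈ lineRoots ![h] b ((1 - s) • v₁ + s • v₂), ∃ a ∈ A, u ∈ ball a ε) :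
    (LineSlice.lineInclHom (affineHypersurfaceComplement ![h]) hb (b + v₁)).range ≤
      (LineSlice.lineInclHom (affineHypersurfaceComplement ![h]) hb (b + v₂)).range := by
  set U := affineHypersurfaceComplement ![h] with hUdef
  rintro g ⟨x, rfl⟩
  induction x using Quotient.ind with | _ γ => ?_
  change LineSlice.lineInclHom U hb (b + v₁) (FundamentalGroup.fromPath (Path.Homotopic.Quotient.mk γ)) ∈ _
  -- push the loop off the discs
  have hx0 : ∀ a ∈ A, ε ≤ dist ((⟨0, LineSlice.zero_mem_lineSlice hb (b + v₁)⟩ :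
      LineSlice.lineSlice U b (b + v₁)) : ℂ) a := fun a ha => by
    rw [dist_comm, dist_zero_right]; exact h0 a ha
  obtain ⟨γ', hγγ', havoid⟩ := exists_mk_eq_forall_le_dist' (lineSlice_add_eq b v₁) hsep hz hzF hF huniq hx0 γ
  -- off the discs, the loop lies in every punctured line of the segment
  have hmemU : ∀ (s : ℝ), 0 ≤ s → s ≤ 1 → ∀ t, b + (γ' t : ℂ) • ((1 - s) • v₁ + s • v₂) ∈ U := by
    intro s hs0 hs1 t
    have hnot : (γ' t : ℂ) ∉ lineRoots ![h] b ((1 - s) • v₁ + s • v₂) := by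
      intro hmem
      obtain ⟨a, ha, hball⟩ := hseg s hs0 hs1 _ hmem
      exact not_lt.2 (havoid t a ha) (mem_ball.1 hball)
    have hc : MvPolynomial.eval (b + (γ' t : ℂ) • ((1 - s) • v₁ + s • v₂)) h ≠ 0 := by
      intro h0
      exact hnot (by rw [lineRoots_eq_setOf_isRoot, mem_setOf_eq, isRoot_linePoly_iff]; exact h0)
    change b + (γ' t : ℂ) • ((1 - s) • v₁ + s • v₂) ∈ affineHypersurfaceComplement ![h]
    rw [mem_affineHypersurfaceComplement_iff]
    intro j; fin_cases j; exact hc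
  -- the loop read in the line `v₂`
  have hmem2 : ∀ t, (γ' t : ℂ) ∈ LineSlice.lineSlice U b (b + v₂) := fun t => by
    rw [LineSlice.mem_lineSlice, LineSlice.linePt, add_sub_cancel_left]
    simpa using hmemU 1 zero_le_one le_rfl t
  have hγ'0 : (γ' 0 : ℂ) = 0 := by rw [γ'.source]
  have hγ'1 : (γ' 1 : ℂ) = 0 := by rw [γ'.target]
  let γ₂ : Path (⟨0, LineSlice.zero_mem_lineSlice hb (b + v₂)⟩ : LineSlice.lineSlice U b (b + v₂))
      ⟨0, LineSlice.zero_mem_lineSlice hb (b + v₂)⟩ :=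
    { toFun := fun t => ⟨(γ' t : ℂ), hmem2 t⟩
      continuous_toFun := (continuous_subtype_val.comp γ'.continuous).subtype_mk _
      source' := Subtype.ext hγ'0
      target' := Subtype.ext hγ'1 }
  refine ⟨FundamentalGroup.fromPath (Path.Homotopic.Quotient.mk γ₂), ?_⟩
  -- both images are the edges of the square `(s, t) ↦ b + γ'(t) v_s`
  rw [show FundamentalGroup.fromPath (Path.Homotopic.Quotient.mk γ) =
      FundamentalGroup.fromPath (Path.Homotopic.Quotient.mk γ') from by rw [hγγ']]
  rw [LineSlice.lineInclHom, LineSlice.lineInclHom, FundamentalGroup.mapOfEq_apply, FundamentalGroup.mapOfEq_apply,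
    ← Path.Homotopic.Quotient.mk_map, ← Path.Homotopic.Quotient.mk_map, ← Path.Homotopic.Quotient.mk_cast,
    ← Path.Homotopic.Quotient.mk_cast]
  change FundamentalGroup.fromPath (Path.Homotopic.Quotient.mk _) = FundamentalGroup.fromPath (Path.Homotopic.Quotient.mk _)
  congr 1
  symm
  have hsq_mem : ∀ p : I × I, b + (γ' p.2 : ℂ) • ((1 - (p.1 : ℝ)) • v₁ + (p.1 : ℝ) • v₂) ∈ U := fun p =>
    hmemU p.1 p.1.2.1 p.1.2.2 p.2
  have hsq_cont : Continuous fun p : I × I => b + (γ' p.2 : ℂ) • ((1 - (p.1 : ℝ)) • v₁ + (p.1 : ℝ) • v₂) := by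
    refine continuous_const.add (Continuous.smul (continuous_subtype_val.comp (γ'.continuous.comp continuous_snd)) ?_)
    have hs : Continuous fun p : I × I => (p.1 : ℝ) := continuous_subtype_val.comp continuous_fst
    exact ((continuous_const.sub hs).smul continuous_const).add (hs.smul continuous_const)
  refine OffDiscs.mk_eq_mk_of_square ⟨fun p => ⟨_, hsq_mem p⟩, hsq_cont.subtype_mk _⟩ _ _
    (fun t => Subtype.ext ?_) (fun t => Subtype.ext ?_) (fun s => Subtype.ext ?_) (fun s => Subtype.ext ?_)
  · change b + (γ' t : ℂ) • ((1 - ((0 : I) : ℝ)) • v₁ + ((0 : I) : ℝ) • v₂) = _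
    rw [Path.cast_coe, Path.map_coe, Function.comp_apply, LineSlice.coe_lineIncl_apply, LineSlice.linePt]
    simp [add_sub_cancel_left]
  · change b + (γ' t : ℂ) • ((1 - ((1 : I) : ℝ)) • v₁ + ((1 : I) : ℝ) • v₂) = _
    rw [Path.cast_coe, Path.map_coe, Function.comp_apply, LineSlice.coe_lineIncl_apply, LineSlice.linePt]
    simp [add_sub_cancel_left, γ₂]
  · change b + (γ' 0 : ℂ) • _ = b
    rw [hγ'0, zero_smul, add_zero]
  · change b + (γ' 1 : ℂ) • _ = b
    rw [hγ'1, zero_smul, add_zero]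

/-- A radius separating finitely many non-zero points from each other (`2ε ≤ |a - a'|`) and from
`0` (`ε ≤ |a|`). [folklore] -/
private theorem exists_separating_radius {R : Set ℂ} (hR : R.Finite) (h0 : (0 : ℂ) ∉ R) :
    ∃ ε : ℝ, 0 < ε ∧ (∀ a ∈ R, ∀ a' ∈ R, a ≠ a' → 2 * ε ≤ dist a a') ∧ ∀ a ∈ R, ε ≤ ‖a‖ := by
  have h1 : ∀ᶠ ε in 𝓝[>] (0 : ℝ), ∀ a ∈ hR.toFinset, ∀ a' ∈ hR.toFinset, a ≠ a' → 2 * ε ≤ dist a a' := by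
    rw [Finset.eventually_all]
    intro a _
    rw [Finset.eventually_all]
    intro a' _
    by_cases hne : a = a'
    · exact Eventually.of_forall fun ε h => absurd hne h
    · have hd : (0 : ℝ) < dist a a' := dist_pos.2 hne
      have ht : Tendsto (fun ε : ℝ => 2 * ε) (𝓝[>] 0) (𝓝 0) := by
        have : Tendsto (fun ε : ℝ => 2 * ε) (𝓝 0) (𝓝 (2 * 0)) := (continuous_const.mul continuous_id).tendsto 0
        rw [mul_zero] at this
        exact this.mono_left nhdsWithin_le_nhds
      exact (ht.eventually_lt_const hd).mono fun ε hε _ => hε.le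
  have h2 : ∀ᶠ ε in 𝓝[>] (0 : ℝ), ∀ a ∈ hR.toFinset, ε ≤ ‖a‖ := by
    rw [Finset.eventually_all]
    intro a ha
    rw [Set.Finite.mem_toFinset] at ha
    have hpos : (0 : ℝ) < ‖a‖ := norm_pos_iff.2 fun h => h0 (h ▸ ha)
    have ht : Tendsto (fun ε : ℝ => ε) (𝓝[>] 0) (𝓝 0) := tendsto_id.mono_left nhdsWithin_le_nhds
    exact (ht.eventually_lt_const hpos).mono fun ε hε => hε.le
  have h3 : ∀ᶠ ε in 𝓝[>] (0 : ℝ), 0 < ε := eventually_mem_nhdsWithin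
  obtain ⟨ε, hε1, hε2, hε3⟩ := (h1.and (h2.and h3)).exists
  refine ⟨ε, hε3, fun a ha a' ha' hne => hε1 a (hR.mem_toFinset.2 ha) a' (hR.mem_toFinset.2 ha') hne,
    fun a ha => hε2 a (hR.mem_toFinset.2 ha)⟩

/-- **Local constancy.**  For `pencilDiscr h (b, v₀) ≠ 0` there is `δ > 0` such that every line `v`
with `|v - v₀| < δ` has the same image `im(π₁(Λ_{b,v}, 0) → π₁(U, b))` as the line `v₀`.
[cite: Dimca1992, Ch. 4 §3 Prop. (3.1) (proof: the transversal lines through `b` form a connected family along which the punctured lines are isotopic)] -/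
theorem exists_ball_range_lineInclHom_eq (hb : b ∈ affineHypersurfaceComplement ![h]) {v₀ : ι → ℂ}
    (hQ : MvPolynomial.eval (Sum.elim b v₀) (pencilDiscr h) ≠ 0) :
    ∃ δ > 0, ∀ v ∈ ball v₀ δ,
      (LineSlice.lineInclHom (affineHypersurfaceComplement ![h]) hb (b + v)).range =
        (LineSlice.lineInclHom (affineHypersurfaceComplement ![h]) hb (b + v₀)).range := by
  classical
  have hbh : MvPolynomial.eval b h ≠ 0 := eval_ne_zero_of_pencilDiscr hQ
  set R₀ := lineRoots ![h] b v₀ with hR₀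
  have hR₀fin : R₀.Finite := lineRoots_finite hb v₀
  have h0R : (0 : ℂ) ∉ R₀ := by
    rw [hR₀, lineRoots_eq_setOf_isRoot, mem_setOf_eq, isRoot_linePoly_iff, zero_smul, add_zero]
    exact hbh
  obtain ⟨ε, hε, hsepR, h0⟩ := exists_separating_radius hR₀fin h0R
  obtain ⟨δ, hδ, hball⟩ := Metric.eventually_nhds_iff_ball.1 (eventually_lineRoots_configuration hQ hε hsepR)
  refine ⟨δ, hδ, fun v hv => ?_⟩
  set A := hR₀fin.toFinset with hA
  have hmemA : ∀ {a}, a ∈ A ↔ a ∈ R₀ := fun {a} => hR₀fin.mem_toFinset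
  have hsepA : ∀ a ∈ A, ∀ a' ∈ A, a ≠ a' → 2 * ε ≤ dist a a' :=
    fun a ha a' ha' => hsepR a (hmemA.1 ha) a' (hmemA.1 ha')
  have h0A : ∀ a ∈ A, ε ≤ ‖a‖ := fun a ha => h0 a (hmemA.1 ha)
  -- the lines of the segments `[v, v₀]`, `[v₀, v]` lie in the ball
  have hsegmem : ∀ (w₁ w₂ : ι → ℂ), w₁ ∈ ball v₀ δ → w₂ ∈ ball v₀ δ → ∀ s : ℝ, 0 ≤ s → s ≤ 1 →
      (1 - s) • w₁ + s • w₂ ∈ ball v₀ δ := fun w₁ w₂ hw₁ hw₂ s hs0 hs1 =>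
    (convex_ball v₀ δ) hw₁ hw₂ (by linarith) hs0 (by ring)
  have hv₀ : v₀ ∈ ball v₀ δ := mem_ball_self hδ
  have hconf : ∀ w ∈ ball v₀ δ, ∀ u ∈ lineRoots ![h] b w, ∃ a ∈ A, u ∈ ball a ε := by
    intro w hw u hu
    obtain ⟨z, -, hcov, -⟩ := hball w hw
    obtain ⟨a, ha, hua⟩ := hcov u hu
    exact ⟨a, hmemA.2 ha, hua⟩
  apply le_antisymm
  · -- `H(v) ≤ H(v₀)`: configuration of the line `v`
    obtain ⟨z, hz, hcov, huniq⟩ := hball v hv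
    exact range_lineInclHom_le_of_discs hb hsepA h0A (fun a ha => (hz a (hmemA.1 ha)).1)
      (fun a ha => (hz a (hmemA.1 ha)).2) (fun u hu => let ⟨a, ha, hua⟩ := hcov u hu; ⟨a, hmemA.2 ha, hua⟩)
      (fun a ha u hu hua => huniq a (hmemA.1 ha) u hu hua)
      (fun s hs0 hs1 u hu => hconf _ (hsegmem v v₀ hv hv₀ s hs0 hs1) u hu)
  · -- `H(v₀) ≤ H(v)`: the trivial configuration of the line `v₀` (the centres themselves)
    exact range_lineInclHom_le_of_discs hb hsepA h0A (z := id) (fun a ha => mem_ball_self hε)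
      (fun a ha => hmemA.1 ha) (fun u hu => ⟨u, hmemA.2 hu, mem_ball_self hε⟩)
      (fun a ha u hu hua => by
        by_contra hne
        have := hsepR a (hmemA.1 ha) u hu (Ne.symm hne)
        have h2 : dist u a < ε := mem_ball.1 hua
        rw [dist_comm] at h2
        linarith)
      (fun s hs0 hs1 u hu => hconf _ (hsegmem v₀ v hv₀ hv s hs0 hs1) u hu)

end LocalConstancy

end Literature.AlgebraicGeometry.FundamentalGroup

end
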